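import Summits.BirchSwinnertonDyer.BirchSwinnertonDyer.Theorems.ManinLocalTwoThreeManinPrimeToAdditiveFiveLeBistarredGord
import Summits.BirchSwinnertonDyer.BirchSwinnertonDyer.Theorems.ManinLocalTwoThreeManinPrimeToAdditiveFiveLeReducibleThirteenDegreeUp
import Summits.BirchSwinnertonDyer.Rank1Residual.ManinAdditive.OrdinaryRamifiedTwistLaw
import Summits.BirchSwinnertonDyer.Rank1Residual.ManinAdditive.TwistOrbitIndexEngineOdd
import Literature.NumberTheory.EllipticCurves.IsogenyConductorModularityProofs
import HarnessLib

/-!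
# Route `ManinLocalTwoThree`, residual crux C5 `ManinPrimeToAdditiveFiveLe`
# (stmt-BirchSwinnertonDyer-22969), line `upper_anchor` (skeleton v8, registered stub `stub_degreeUp13Red`):
# **the degree law at 13 IS the cell's registered conjecture E-imc-9 `OrdinaryRamifiedTwistLaw 13`**

Width seat bsd-line-ml23-c5-p1-w2 (gen 4), piece υ2 (sequel of υ, p626338, which identified v8's law (U) with
E-imc-5). Skeleton v8 of the line (`Cruxes/ManinPrimeToAdditiveFiveLe/Lines/upper_anchor.lean`, sha16
f41b6313bdbd3fbd) carries the Manin-free stub `stub_degreeUp13Red` (the lead's gen-3 reshape of RED(13♯),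
p618203): «for `W` globally minimal with a lattice-optimal conductor-level datum `D`, `13² ∣ N(W)`, twist-minimal,
`W[13]` reducible, `ord₁₃ Δ_min(W) ≤ 4`, (G)-ordinary at 13, `13 ∣ deg(D)`, `N > 5·10⁵`, and EVERY globally
minimal `W′` with a lattice-optimal conductor-level datum `D′`, `N(W′) = N(W)`, `W ⊗ 13 ∼ W′`:
`deg(D′) = 13·deg(D)`». This file shows it is a COROLLARY of the imc planner's registered, refuter-vetted
`@[conjecture]` E-imc-9 `Summit.BirchSwinnertonDyer.Rank1Residual.ManinAdditive.OrdinaryRamifiedTwistLaw 13`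
(«at a potentially good ORDINARY additive `p ≥ 5`, from the unstarred end the ramified twist `W ⊗ χ_{p*}` is
again `X₀`-optimal and every optimal datum of it has degree exactly `p·deg`»; REF1 SURVIVES 2026-08-27T16:22Z,
85 108 / 85 108 exact ratio `p` in range) and modularity (`exists_isNewformOf`, already a binder of the stub).

* `degreeUp13Red_of_ordinaryRamifiedTwistLaw` — **`stub_degreeUp13Red` VERBATIM ⟸ `OrdinaryRamifiedTwistLaw 13`.**
  Proof. The stub's (G)-ordinary clause is the tree's `HasPotentiallyGoodOrdinaryReductionAtPrime 13`
  (a subfield of `ℚ(ζ₁₃)` is a number field with a place above 13). Run the an-cell's PROVED optimal-orbit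
  trichotomy at `q = 13` (`pStar_optimal_orbit_trichotomy_full`) on `(D, D′)`: (i) `W ⊗ 13 ≅ W′`, `deg′ = 13·deg`
  — done; (ii) `W ⊗ 13 ≅ W′ = u • (W ⊗ 13)` — then clause 2 of E-imc-9 with `C = u` gives `deg(D′) = 13·deg(D)`
  outright; (iii) FLIP, `deg′ = deg` — impossible: by clause 1 of E-imc-9 a globally minimal model
  `W₁ = C₀ • (W ⊗ 13)` carries a lattice-optimal conductor-level datum `D₁`, of degree `13·deg` by clause 2;
  `W₁ ∼ W′` (both in the class of `W ⊗ 13`), so `N(W₁) = N(W′)` (conductor is an isogeny invariant granted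
  modularity, `conductorNorm_eq_of_isIsogenous_of_modularity`), their newforms have the same coefficients
  (`IsIsogenous.LFunction_eq`) hence the same period lattice (`periodLattice_eq_of_level_eq_of_cuspCoeff_eq`,
  q-expansion principle), and the an-cell's PROVED index engine at the trivial twist `s = 1`
  (`optimal_orbit_index_engine`: `m·m′ = 1`, `m·deg₁ = deg′`) gives `deg(D₁) = deg(D′)`; so `13·deg = deg`,
  against `deg > 0`. The stub's twist-minimality, reducibility, `13 ∣ deg`, `N > 5·10⁵` binders are idle.
* `red13sharp_of_edixhovenKodairaFact_of_ordinaryRamifiedTwistLaw` — RED(13♯) (hypothesis `h13s` of p614544,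
  verbatim) ⟸ EdK ∧ `OrdinaryRamifiedTwistLaw 13` (the lead's p618203 fed with the above).

Net effect on the line's ledger (with υ, p626338): the v8 residual {ANCHOR, U, DegreeUp13Red} reads {ANCHOR,
E-imc-5(5) ∧ E-imc-5(7), E-imc-9(13)} — BOTH optimality stubs of the C5 line are the imc cell's registered
conjectures read at C5's primes; no optimality law private to the line remains. HONEST STATUS: conditional-result
helpers (`--supports … --as helper`): E-imc-9 is an OPEN conjecture of the cell (not in print); nothing here proves
BSD, Manin's conjecture, E-imc-9 or C5.

References: [DokchitserDokchitser2015LocalInvariants] Thm. 7 / Cor. 8 (the T–T*-isogeny half of E-imc-9a);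
[Watkins2002] §2.1 (degree identity under twists, shape only); [ZagierCMB1985] §1 (deg·covol = 4π²c²(f,f));
[Stevens1989] Lemmas (5.2), (5.4); [DiamondShurman2005] §5.8 (q-expansion principle), Thm. 8.8.3 (modularity);
[EdixhovenManin1991] Thm. 3, §4; cell bsd-f2-manin MEMO-imc.md §10 (E-imc-9).
-/

set_option autoImplicit false
-- the Theorems namespace of this sub repeats the summit name by design (D-0017 nested layout)
set_option linter.dupNamespace false

noncomputable section

open scoped Classical NumberField

namespace Summit.BirchSwinnertonDyer.BirchSwinnertonDyer.Theorems

open WeierstrassCurve IsDedekindDomain IsDedekindDomain.HeightOneSpectrum Rat.HeightOneSpectrum NumberField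
  Literature.NumberTheory.EllipticCurves Literature.NumberTheory.EllipticCurves.ModularForms
  Literature.NumberTheory.EllipticCurves.Rank1Residual
  Summit.BirchSwinnertonDyer.Rank1Residual.ManinAdditive
  Summit.BirchSwinnertonDyer.Rank1Residual.Additive
  Summit.BirchSwinnertonDyer.BirchSwinnertonDyer.Theses.EdixhovenFibreFiveSeven

/-! ## §0 Plumbing: the period lattice of a newform does not depend on how its level is spelled -/

/-- **Two cusp forms on `Γ₀` of propositionally equal levels with the same `q`-expansion have the same period
lattice** (q-expansion principle `eq_of_forall_cuspCoeff_eq_gamma0` after `subst`). Used for the newforms of two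
lattice-optimal data of ISOGENOUS curves, whose levels `N(W₁)`, `N(W′)` are equal numbers but different terms.
[cite: DiamondShurman2005, §5.8 (q-expansion principle)] -/
theorem periodLattice_eq_of_level_eq_of_cuspCoeff_eq {N₁ N₂ : ℕ} (h : N₁ = N₂)
    (f₁ : CuspForm (CongruenceSubgroup.Gamma0 N₁) 2) (f₂ : CuspForm (CongruenceSubgroup.Gamma0 N₂) 2)
    (hc : ∀ n : ℕ, cuspCoeff f₁ n = cuspCoeff f₂ n) : periodLattice f₁ = periodLattice f₂ := by
  subst h
  obtain rfl : f₁ = f₂ := eq_of_forall_cuspCoeff_eq_gamma0 hc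
  rfl

/-! ## §1 Stub `stub_degreeUp13Red` of skeleton v8, verbatim, from E-imc-9 at 13 -/

/-- **`stub_degreeUp13Red` (skeleton v8 of line `upper_anchor` = hypothesis `hUp` of p618203, VERBATIM) ⟸ E-imc-9
`OrdinaryRamifiedTwistLaw 13`.** `hO`: the imc cell's ordinary-detwist law at `p = 13` (an OPEN conjecture, taken
as a hypothesis). Trichotomy (an-cell, PROVED) on the two lattice-optimal data: commuting-up is the claim;
commuting-down contradicts clause 2 of `hO` outright; a flip (`deg′ = deg`) is killed by clause 1 of `hO` (the twist
model is optimal, of degree `13·deg`) and the uniqueness of the optimal degree inside the class of `W ⊗ 13` (index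
engine at `s = 1` over the common period lattice of the common newform; conductor is an isogeny invariant granted
the stub's own modularity binder). Conditional result (open conjecture of the cell); closes nothing.
[cite: ZagierCMB1985, §1] [cite: DiamondShurman2005, §5.8 and Thm. 8.8.3] [cite: Watkins2002, §2.1] -/
theorem degreeUp13Red_of_ordinaryRamifiedTwistLaw (hO : OrdinaryRamifiedTwistLaw 13) :
    exists_isNewformOf →
    ∀ (W : WeierstrassCurve ℚ) [W.IsElliptic] [W.IsGloballyMinimal] [NeZero (W.conductorNorm ℤ)]
      (D : ModularParametrizationData W (W.conductorNorm ℤ)),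
      IsLatticeOptimal D → ∀ p : ℕ, p.Prime → p = 13 → p ^ 2 ∣ W.conductorNorm ℤ →
      ¬ (∃ (W' : WeierstrassCurve ℚ) (q : ℕ), W'.IsElliptic ∧ W'.IsGloballyMinimal ∧ q.Prime ∧
          q ≠ 2 ∧ q ^ 2 ∣ W.conductorNorm ℤ ∧
          IsIsogenous W (W'.quadraticTwist (((-1 : ℤ) ^ (q / 2) * q : ℤ) : ℚ)) ∧
          ¬ q ^ 2 ∣ W'.conductorNorm ℤ) →
      ¬ (∃ (W' : WeierstrassCurve ℚ) (d : ℤ), W'.IsElliptic ∧ W'.IsGloballyMinimal ∧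
          (d = -1 ∨ d = 2 ∨ d = -2) ∧ 2 ^ 2 ∣ W.conductorNorm ℤ ∧
          IsIsogenous W (W'.quadraticTwist (d : ℚ)) ∧ ¬ 2 ^ 2 ∣ W'.conductorNorm ℤ) →
      ¬ W.HasIrreducibleModPGaloisRep p →
      padicValInt p W.minimalDiscriminantInt ≤ 4 →
      (∃ (L : Type) (_ : Field L) (_ : NumberField L) (_ : IsCyclotomicExtension {p} ℚ L)
          (F : IntermediateField ℚ L),
          ∀ w : HeightOneSpectrum (𝓞 F), (p : 𝓞 F) ∈ w.asIdeal →
            (W.baseChange F).HasGoodReductionAt w ∧ (W.baseChange F).HasUnitRootAt w) →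
      p ∣ D.modularDegree →
      500000 < W.conductorNorm ℤ →
      ∀ (W' : WeierstrassCurve ℚ) [W'.IsElliptic] [W'.IsGloballyMinimal] [NeZero (W'.conductorNorm ℤ)]
        (D' : ModularParametrizationData W' (W'.conductorNorm ℤ)),
        IsLatticeOptimal D' → W'.conductorNorm ℤ = W.conductorNorm ℤ →
        IsIsogenous (W.quadraticTwist (((-1 : ℤ) ^ (p / 2) * p : ℤ) : ℚ)) W' →
        D'.modularDegree = p * D.modularDegree := by
  intro hnf W _ _ _ D hD p hp h13 hpN _hodd _hdy _hred hv hT _hdeg _hN W' _ _ _ D' hD' hNN hiso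
  subst h13
  haveI hpF : Fact (13 : ℕ).Prime := ⟨hp⟩
  have h5 : 5 ≤ 13 := by norm_num
  -- (G)-ordinary ⟹ potentially good ordinary in the tree's sense
  have hpo : W.HasPotentiallyGoodOrdinaryReductionAtPrime 13 := by
    obtain ⟨L, iF, iN, iC, F, hF⟩ := hT
    haveI : NumberField F := NumberField.of_module_finite ℚ F
    obtain ⟨w, hw⟩ := exists_heightOneSpectrum_natCast_mem F 13
    exact ⟨F, inferInstance, inferInstance, w, hw, hF w hw⟩
  have hv6 : padicValInt 13 W.minimalDiscriminantInt < 6 := by omega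
  rcases pStar_optimal_orbit_trichotomy_full hp (by norm_num) W W' D D' hD hD' hpN hNN hiso with
    ⟨-, hdeg', -⟩ | ⟨⟨u, hu⟩, -, -⟩ | hdeg'
  · exact hdeg'
  · exact (hO W W' D u hp h5 hpN hpo hv6 hD hu).2 D' hD'
  · -- the flip is impossible under E-imc-9
    exfalso
    have hd0 : ((((-1 : ℤ) ^ (13 / 2) * 13 : ℤ)) : ℚ) ≠ 0 := by norm_num
    haveI : (W.quadraticTwist ((((-1 : ℤ) ^ (13 / 2) * 13 : ℤ)) : ℚ)).IsElliptic := W.isElliptic_quadraticTwist hd0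
    obtain ⟨C₀, hmin⟩ := hasGlobalMinimalModel_rat_holds (W.quadraticTwist ((((-1 : ℤ) ^ (13 / 2) * 13 : ℤ)) : ℚ))
    haveI := hmin
    -- `W₁ := C₀ • (W ⊗ 13) ∼ W′`, so `N(W₁) = N(W′)` (granted modularity)
    have hiso1 : IsIsogenous (C₀ • W.quadraticTwist ((((-1 : ℤ) ^ (13 / 2) * 13 : ℤ)) : ℚ)) W' :=
      (isIsogenous_of_smul (W.quadraticTwist ((((-1 : ℤ) ^ (13 / 2) * 13 : ℤ)) : ℚ)) C₀).trans' hiso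
    have hN1 : (C₀ • W.quadraticTwist ((((-1 : ℤ) ^ (13 / 2) * 13 : ℤ)) : ℚ)).conductorNorm ℤ =
        W'.conductorNorm ℤ :=
      conductorNorm_eq_of_isIsogenous_of_modularity
        (nonempty_modularParametrizationData_of_exists_isNewformOf hnf
          IsNewformOf.exists_maninConstant_ne_zero_holds) _ _ hiso1
    haveI : NeZero ((C₀ • W.quadraticTwist ((((-1 : ℤ) ^ (13 / 2) * 13 : ℤ)) : ℚ)).conductorNorm ℤ) :=
      ⟨by rw [hN1]; exact NeZero.ne _⟩
    -- E-imc-9: the twist model is optimal, with degree `13·deg`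
    obtain ⟨⟨D₁, hD₁⟩, hall⟩ :=
      hO W (C₀ • W.quadraticTwist ((((-1 : ℤ) ^ (13 / 2) * 13 : ℤ)) : ℚ)) D C₀ hp h5 hpN hpo hv6 hD rfl
    have hdeg₁ : D₁.modularDegree = 13 * D.modularDegree := hall D₁ hD₁
    -- the two optimal data of the class share the newform's period lattice
    have hcoefEq : ∀ n : ℕ, cuspCoeff D₁.f n = cuspCoeff D'.f n := fun n ↦ by
      rw [D₁.isNewformOf.2 n, D'.isNewformOf.2 n, hiso1.LFunction_eq]
    have hΛ : periodLattice D₁.f = periodLattice D'.f :=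
      periodLattice_eq_of_level_eq_of_cuspCoeff_eq hN1 D₁.f D'.f hcoefEq
    have h1 : ∀ w ∈ periodLattice D₁.f, (1 : ℂ) * w ∈ periodLattice D'.f := fun w hw ↦ by
      rw [one_mul, ← hΛ]; exact hw
    have h2 : ∀ w ∈ periodLattice D'.f, (1 : ℂ) * w ∈ periodLattice D₁.f := fun w hw ↦ by
      rw [one_mul, hΛ]; exact hw
    have hcoef : ∀ n : ℕ, ‖cuspCoeff D₁.f n‖ = ‖cuspCoeff D'.f n‖ := fun n ↦ by rw [hcoefEq]
    have ha : ‖(1 : ℂ)‖ ^ 2 = ((1 : ℕ) : ℝ) := by simp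
    have hc' : (D'.c : ℂ) ≠ 0 := by exact_mod_cast D'.maninConstant_ne_zero_holds
    have hc₁ : (D₁.c : ℂ) ≠ 0 := by exact_mod_cast D₁.maninConstant_ne_zero_holds
    have ht : (D'.c : ℂ) * 1 / (D₁.c : ℂ) ≠ 0 := div_ne_zero (by rw [mul_one]; exact hc') hc₁
    have ht' : (D₁.c : ℂ) * 1 / (D'.c : ℂ) ≠ 0 := div_ne_zero (by rw [mul_one]; exact hc₁) hc'
    obtain ⟨hmm, hmdeg⟩ := optimal_orbit_index_engine hN1 D' D₁ hD' hD₁ ha h1 h2 hcoef ht ht'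
    rw [one_pow] at hmm
    have hm1 := Nat.eq_one_of_mul_eq_one_right hmm
    rw [hm1, one_mul, one_mul] at hmdeg
    -- `deg(D₁) = deg(D′) = deg(D)` against `deg(D₁) = 13·deg(D)`, `deg(D) > 0`
    have hpos : 0 < D.modularDegree := D.deg_pos
    omega

/-! ## §2 RED(13♯) modulo EdK and E-imc-9 -/

/-- **RED(13♯) (hypothesis `h13s` of `coreRED13_of_cremona_of_coreRED13sharp`, p614544, VERBATIM) ⟸ Edixhoven's
Kodaira statement ∧ E-imc-9 `OrdinaryRamifiedTwistLaw 13`** (the lead's p618203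
`coreRED13sharp_of_edixhovenKodairaFact_of_degreeUp13Red` fed with §1). Conditional result; closes nothing.
[cite: EdixhovenManin1991, Thm. 3 and §4] -/
theorem red13sharp_of_edixhovenKodairaFact_of_ordinaryRamifiedTwistLaw
    (hEdK : edixhoven_not_dvd_maninConstant_of_kodairaSymbol_ne) (hO : OrdinaryRamifiedTwistLaw 13) :
    mazur_not_dvd_maninConstant_of_odd → abbesUllmo_not_dvd_maninConstant_of_not_dvd_level →
    cesnavicius_not_two_dvd_maninConstant_of_two_dvd_level → exists_isNewformOf →
    ∀ (W : WeierstrassCurve ℚ) [W.IsElliptic] [W.IsGloballyMinimal] [NeZero (W.conductorNorm ℤ)]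
      (D : ModularParametrizationData W (W.conductorNorm ℤ)),
      IsLatticeOptimal D → ∀ p : ℕ, p.Prime → p = 13 → p ^ 2 ∣ W.conductorNorm ℤ →
      ¬ (∃ (W' : WeierstrassCurve ℚ) (q : ℕ), W'.IsElliptic ∧ W'.IsGloballyMinimal ∧ q.Prime ∧
          q ≠ 2 ∧ q ^ 2 ∣ W.conductorNorm ℤ ∧
          IsIsogenous W (W'.quadraticTwist (((-1 : ℤ) ^ (q / 2) * q : ℤ) : ℚ)) ∧
          ¬ q ^ 2 ∣ W'.conductorNorm ℤ) →
      ¬ (∃ (W' : WeierstrassCurve ℚ) (d : ℤ), W'.IsElliptic ∧ W'.IsGloballyMinimal ∧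
          (d = -1 ∨ d = 2 ∨ d = -2) ∧ 2 ^ 2 ∣ W.conductorNorm ℤ ∧
          IsIsogenous W (W'.quadraticTwist (d : ℚ)) ∧ ¬ 2 ^ 2 ∣ W'.conductorNorm ℤ) →
      ¬ W.HasIrreducibleModPGaloisRep p →
      padicValInt p W.minimalDiscriminantInt ≤ 4 →
      (∃ (L : Type) (_ : Field L) (_ : NumberField L) (_ : IsCyclotomicExtension {p} ℚ L)
          (F : IntermediateField ℚ L),
          ∀ w : HeightOneSpectrum (𝓞 F), (p : 𝓞 F) ∈ w.asIdeal →
            (W.baseChange F).HasGoodReductionAt w ∧ (W.baseChange F).HasUnitRootAt w) →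
      p ∣ D.modularDegree →
      500000 < W.conductorNorm ℤ →
      ¬ (p : ℤ) ∣ D.maninConstant :=
  coreRED13sharp_of_edixhovenKodairaFact_of_degreeUp13Red hEdK (degreeUp13Red_of_ordinaryRamifiedTwistLaw hO)

end Summit.BirchSwinnertonDyer.BirchSwinnertonDyer.Theorems

end
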